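import Mathlib
import Summits.Ventures.HodgeRepro2.T6A1DictHodge

/-!
# T6A1DictHodge2 — the degree-2 dictionary: `H^{1,1}(B)` and the Lefschetz (1,1) discharge shape

Tier-6 sub-goal A1, Layer III (owner t6-p1, gen 2). The transfer shadow's field `alg_lefschetz`
(`T6Interface`: a rational degree-2 class of the model of Hodge type `(1,1)` is algebraic) is discharged in
Layer III from Lefschetz (1,1) ON THE HOST (t6-p2's display, TARGET-T6 §3 row H3) once the model's
`hodge F 1 1 = ιW (h10 F) * ιW (h01 F)` is identified with the host's `(1,1)`-classes. This file builds the
degree-2 map `lange2 φ₁ e2 : H^*(B, ℂ)_model →ₗ[ℂ] V2` from `φ₁` and Lange's `e2 : ⋀² V1 ≃ V2` on cup products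
(Lange–Birkenhake Prop. 1.1.20, the `n = 2` clause of `T6A1HypHost.LangeBirkenhake1992_Prop1_1_20`),
shows `lange2 (ι a * ι b) = cup2 (φ₁ a) (φ₁ b)` (`lange2_ι_mul_ι`), transports the Hodge piece
(`map_hodge11_eq`: `lange2 (hodge F 1 1)` = the span of `cup2 a b` with `a` of type `(1,0)`, `b` of type
`(0,1)` — Lange Thm. 1.1.21(b) in the display's words, given `φ₁ (h10 F) = h10V`, `φ₁ (h01 F) = h01V` from
`T6A1DictHodge`), proves that `lange2 ∘ extC` sends rational model classes of degree 2 to rational host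
classes when cup products of rational classes are rational (`ratl2_lange2_extC`), and assembles THE
LEFSCHETZ DISCHARGE SHAPE `alg_lefschetz_of`: «`a ∈ H²(B, ℚ)`, `extC a ∈ hodge F 1 1` ⟹ `lange2 (extC a)`
is algebraic» from the host's Lefschetz (1,1) — exactly `TransferShadow.alg_lefschetz` for an `Alg 1`
defined as the preimage of the host's algebraic classes. §8(d): uses an L-value-free non-vanishing device: NO.
-/

namespace Summit.Ventures.HodgeRepro2.T6.A1DictHodge2

open A1Dict A1DictHodge A2Model

section degree2

variable {K : Type*} [Field K] [NumberField K]
variable {V1 V2 : Type*} [AddCommGroup V1] [Module ℂ V1] [AddCommGroup V2] [Module ℂ V2]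

/-- The degree-2 component of `H^*(B, ℂ)`, as a `ℂ`-linear map into `⋀² H¹(B, ℂ)`. -/
noncomputable def proj2C : HBC K →ₗ[ℂ] ⋀[ℂ]^2 (H1C K) :=
  (DirectSum.component ℂ ℕ (fun i : ℕ => ⋀[ℂ]^i (H1C K)) 2) ∘ₗ
    (DirectSum.decomposeLinearEquiv (fun i : ℕ => ⋀[ℂ]^i (H1C K))).toLinearMap

/-- `proj2C` is the identity on `H²(B, ℂ)`. -/
theorem proj2C_of_mem {x : HBC K} (hx : x ∈ degBC K 2) : (proj2C (K := K) x : HBC K) = x := by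
  show ((DirectSum.decompose (fun i : ℕ => ⋀[ℂ]^i (H1C K)) x) 2 : HBC K) = x
  exact DirectSum.decompose_of_mem_same _ hx

/-- `proj2C` on a wedge of two vectors. -/
theorem proj2C_ιMulti (v : Fin 2 → H1C K) :
    proj2C (K := K) (ExteriorAlgebra.ιMulti ℂ 2 v) = exteriorPower.ιMulti ℂ 2 v := by
  apply Subtype.ext
  rw [proj2C_of_mem (ExteriorAlgebra.ιMulti_range ℂ 2 ⟨_, rfl⟩)]
  rfl

/-- `ιMulti ℂ 2 v = ι (v 0) * ι (v 1)`. -/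
theorem ιMulti_two (v : Fin 2 → H1C K) :
    ExteriorAlgebra.ιMulti ℂ 2 v = ExteriorAlgebra.ι ℂ (v 0) * ExteriorAlgebra.ι ℂ (v 1) := by
  rw [ExteriorAlgebra.ιMulti_apply]
  simp only [List.ofFn_succ, List.ofFn_zero, List.prod_cons, List.prod_nil, mul_one]
  rfl

/-- The degree-2 map from `φ₁` and Lange's `e2 : ⋀² V1 ≃ V2`. -/
noncomputable def lange2 (φ₁ : H1C K ≃ₗ[ℂ] V1) (e2 : ⋀[ℂ]^2 V1 ≃ₗ[ℂ] V2) : HBC K →ₗ[ℂ] V2 :=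
  e2.toLinearMap ∘ₗ exteriorPower.map 2 φ₁.toLinearMap ∘ₗ proj2C

/-- `lange2` on a wedge of two vectors. -/
theorem lange2_ιMulti (φ₁ : H1C K ≃ₗ[ℂ] V1) (e2 : ⋀[ℂ]^2 V1 ≃ₗ[ℂ] V2) (v : Fin 2 → H1C K) :
    lange2 φ₁ e2 (ExteriorAlgebra.ιMulti ℂ 2 v) = e2 (exteriorPower.ιMulti ℂ 2 (φ₁ ∘ v)) := by
  simp only [lange2, LinearMap.comp_apply, proj2C_ιMulti, exteriorPower.map_apply_ιMulti,
    LinearEquiv.coe_coe]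

variable {cup2 : V1 → V1 → V2}

/-- `lange2 (ι a * ι b) = cup2 (φ₁ a) (φ₁ b)` when `e2` is Lange's isomorphism on cup products. -/
theorem lange2_ι_mul_ι (φ₁ : H1C K ≃ₗ[ℂ] V1) (e2 : ⋀[ℂ]^2 V1 ≃ₗ[ℂ] V2)
    (he2 : ∀ v : Fin 2 → V1, e2 (exteriorPower.ιMulti ℂ 2 v) = cup2 (v 0) (v 1)) (a b : H1C K) :
    lange2 φ₁ e2 (ExteriorAlgebra.ι ℂ a * ExteriorAlgebra.ι ℂ b) = cup2 (φ₁ a) (φ₁ b) := by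
  rw [show ExteriorAlgebra.ι ℂ a * ExteriorAlgebra.ι ℂ b = ExteriorAlgebra.ιMulti ℂ 2 ![a, b] from
    (ιMulti_two ![a, b]).symm, lange2_ιMulti, he2]
  rfl

/-- The host's `(1,1)`-span: the `ℂ`-span of the cup products of a `(1,0)`-class and a `(0,1)`-class
(Lange Thm. 1.1.21(b) in the display's words). -/
def span11 (cup2 : V1 → V1 → V2) (h10V h01V : Submodule ℂ V1) : Submodule ℂ V2 :=
  Submodule.span ℂ {w | ∃ a ∈ h10V, ∃ b ∈ h01V, w = cup2 a b}

/-- THE `(1,1)` TRANSPORT: `lange2 (hodge F 1 1) = span11 cup2 h10V h01V` once `φ₁ (h10 F) = h10V` and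
`φ₁ (h01 F) = h01V`. -/
theorem map_hodge11_eq {F : FaceSetting K} (φ₁ : H1C K ≃ₗ[ℂ] V1) (e2 : ⋀[ℂ]^2 V1 ≃ₗ[ℂ] V2)
    (he2 : ∀ v : Fin 2 → V1, e2 (exteriorPower.ιMulti ℂ 2 v) = cup2 (v 0) (v 1))
    {h10V h01V : Submodule ℂ V1} (hV10 : (h10 F).map (φ₁ : H1C K →ₗ[ℂ] V1) = h10V)
    (hV01 : (h01 F).map (φ₁ : H1C K →ₗ[ℂ] V1) = h01V) :
    (hodge F 1 1).map (lange2 φ₁ e2) = span11 cup2 h10V h01V := by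
  subst hV10 hV01
  unfold hodge
  simp only [pow_one]
  apply le_antisymm
  · rw [Submodule.map_le_iff_le_comap, Submodule.mul_le]
    rintro _ ⟨a, ha, rfl⟩ _ ⟨b, hb, rfl⟩
    rw [Submodule.mem_comap, lange2_ι_mul_ι φ₁ e2 he2]
    exact Submodule.subset_span ⟨φ₁ a, Submodule.mem_map_of_mem ha, φ₁ b, Submodule.mem_map_of_mem hb, rfl⟩
  · rw [span11, Submodule.span_le]
    rintro _ ⟨_, ⟨a, ha, rfl⟩, _, ⟨b, hb, rfl⟩, rfl⟩
    refine ⟨ExteriorAlgebra.ι ℂ a * ExteriorAlgebra.ι ℂ b,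
      Submodule.mul_mem_mul (Submodule.mem_map_of_mem ha) (Submodule.mem_map_of_mem hb), ?_⟩
    exact lange2_ι_mul_ι φ₁ e2 he2 a b

/-- `extC` on a wedge of two rational vectors. -/
theorem extC_ιMulti_two (w : Fin 2 → H1 K) :
    extC K (ExteriorAlgebra.ιMulti ℚ 2 w) = ExteriorAlgebra.ιMulti ℂ 2 (h1ToC K ∘ w) := by
  rw [ExteriorAlgebra.ιMulti_apply, ExteriorAlgebra.ιMulti_apply, map_list_prod, List.map_ofFn]
  congr 1
  exact congrArg List.ofFn (funext fun i => by simp only [Function.comp_apply, extC_ι])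

end degree2

section lefschetz

variable {K : Type*} [Field K] [NumberField K]
variable {V1 : Type*} [AddCommGroup V1] [Module ℂ V1] [Module ℚ V1] [IsScalarTower ℚ ℂ V1]
variable {V2 : Type*} [AddCommGroup V2] [Module ℂ V2]
variable {F : FaceSetting K} {act : K →+* Module.End ℂ V1} {h10V h01V : Submodule ℂ V1}
  {ratl1 : V1 → Prop} (I : FactorIdent F act h10V h01V ratl1)
variable {cup2 : V1 → V1 → V2} (ratl2 : V2 → Prop)

/-- `lange2 ∘ extC` sends rational model classes of degree 2 to rational host classes, when the cup product
of two rational classes is rational and rational classes are closed under `+` and `ℚ`-scalars. -/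
theorem ratl2_lange2_extC (hdeg : Module.finrank ℚ K = 6) (e2 : ⋀[ℂ]^2 V1 ≃ₗ[ℂ] V2)
    (he2 : ∀ v : Fin 2 → V1, e2 (exteriorPower.ιMulti ℂ 2 v) = cup2 (v 0) (v 1))
    (hcup : ∀ a b : V1, ratl1 a → ratl1 b → ratl2 (cup2 a b))
    (hzero : ratl2 0) (hadd : ∀ c d : V2, ratl2 c → ratl2 d → ratl2 (c + d))
    (hsmul : ∀ (q : ℚ) (c : V2), ratl2 c → ratl2 ((q : ℂ) • c)) :
    ∀ a ∈ degB K 2, ratl2 (lange2 (I.phi hdeg) e2 (extC K a)) := by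
  intro a ha
  have ha' : a ∈ Submodule.span ℚ (Set.range (ExteriorAlgebra.ιMulti ℚ 2 (M := H1 K))) := by
    rw [ExteriorAlgebra.ιMulti_span_fixedDegree]; exact ha
  refine Submodule.span_induction (p := fun a _ => ratl2 (lange2 (I.phi hdeg) e2 (extC K a))) ?_ ?_ ?_ ?_
    ha'
  · rintro _ ⟨w, rfl⟩
    rw [extC_ιMulti_two, ιMulti_two, lange2_ι_mul_ι _ _ he2]
    exact hcup _ _ (I.ratl1_phi_h1ToC hdeg _) (I.ratl1_phi_h1ToC hdeg _)
  · simpa using hzero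
  · intro a b _ _ ha hb
    rw [map_add, map_add]; exact hadd _ _ ha hb
  · intro q a _ ha
    rw [map_smul (extC K), ← algebraMap_smul ℂ q (extC K a), map_smul, eq_ratCast]
    exact hsmul q _ ha

/-- THE LEFSCHETZ (1,1) DISCHARGE SHAPE: from Lefschetz (1,1) on the host (`hLef`: a rational class in the
host's `(1,1)`-classes `hodge11V` is in `alg1`) and the `(1,1)` clause of Lange Thm. 1.1.21 (`hspan`:
`span11 cup2 h10V h01V ≤ hodge11V`), a rational degree-2 class of the model of Hodge type `(1,1)` has
`lange2 (extC a) ∈ alg1` — `TransferShadow.alg_lefschetz` for `Alg 1 := (lange2 ∘ extC)⁻¹ alg1`. -/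
theorem alg_lefschetz_of (hdeg : Module.finrank ℚ K = 6) (e2 : ⋀[ℂ]^2 V1 ≃ₗ[ℂ] V2)
    (he2 : ∀ v : Fin 2 → V1, e2 (exteriorPower.ιMulti ℂ 2 v) = cup2 (v 0) (v 1))
    (hcup : ∀ a b : V1, ratl1 a → ratl1 b → ratl2 (cup2 a b))
    (hzero : ratl2 0) (hadd : ∀ c d : V2, ratl2 c → ratl2 d → ratl2 (c + d))
    (hsmul : ∀ (q : ℚ) (c : V2), ratl2 c → ratl2 ((q : ℂ) • c))
    (hodge11V alg1 : Submodule ℂ V2) (hspan : span11 cup2 h10V h01V ≤ hodge11V)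
    (hLef : ∀ c : V2, ratl2 c → c ∈ hodge11V → c ∈ alg1) :
    ∀ a ∈ degB K 2, extC K a ∈ hodge F 1 1 → lange2 (I.phi hdeg) e2 (extC K a) ∈ alg1 := by
  intro a ha hH
  refine hLef _ (ratl2_lange2_extC I ratl2 hdeg e2 he2 hcup hzero hadd hsmul a ha) (hspan ?_)
  rw [← map_hodge11_eq (I.phi hdeg) e2 he2 (I.map_h10 hdeg) (I.map_h01 hdeg)]
  exact Submodule.mem_map_of_mem hH

end lefschetz

end Summit.Ventures.HodgeRepro2.T6.A1DictHodge2
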